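import Summits.Parity.GeneralizedHardyLittlewood.Theorems.BeyondDiagonalBeatsQuarter.OffDiagDualTruncationBox
import HarnessLib

/-!
# Route `PrimeLevelFamEdge`, crux K_B (stmt-Parity-20343), line `diagonal_kernel_split` rev 4, plan Ω —
# L7d part 2, node D5a `OffDiagShiftedLatticeTail`: **the tail of a box transform along a SHIFTED ONE-DIMENSIONAL lattice
# in the second variable, `Σ_{s : |s + τh| > T} ‖Φ̂(ξ₁, s/h + τ)‖ ≤ 2^{k+1}·(|h|/2π)^k·∫∫‖∂₂^kΦ‖·(T−1)^{1−k}`**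

After the switch to `(h₁, s)`-coordinates (S3) and the kernel split (`OffDiagCoreSplit`), the a8R piece `coreL` carries, for
each cell and dual modulus `h₁`, the FULL admissible `s`-series of `Φ̂_q(h₁/(qc), s/h₁ + ab/(h₁qc))` weighted by the
large-conductor kernel (bounded by `1`) — NOT the hyperbola-supported series, so prover-2's two-dimensional lattice tails
(`OffDiagDualTruncationTails/Box`) do not apply to it. The large sieve (E18, `OffDiagLevelLargeSieve`) needs a FINITE family
`(cell, h₁, s)`; this file supplies the `s`-truncation estimate:

* `sum_inv_pow_abs_add_le` — for a real shift `u`, `k ≥ 2`, `T ≥ 2` and a finite `S ⊆ {s ∈ ℤ : |s + u| > T}`: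
  `Σ_{s∈S} |s+u|^{−k} ≤ 2^{k+1}·(T−1)^{1−k}` (reduction to the tree's `sum_inv_pow_abs_int_le` at the integer shift `⌊u⌋`);
* **`sum_shifted_tail_norm_fourier2_le`**, **`tsum_shifted_tail_norm_fourier2_le`** — for `uncurry Φ` smooth of compact
  support, `h ≠ 0`, `τ, ξ₁ ∈ ℝ`, `k ≥ 2`, `T ≥ 2`:
  `Σ'_{s} 𝟙[T < |s + τh|]·‖Φ̂(ξ₁, s/h + τ)‖ ≤ 2^{k+1}·(|h|/(2π))^k·(∫∫‖∂₂^kΦ‖)·((T−1)^{k−1})⁻¹`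
  (pointwise `k` partial integrations `norm_fourier2_le_right_pow_of_contDiff`, prover-2);
* **`tsum_shifted_tail_norm_fourier2_boxWeight_le`** — for the box weight `Φ_i` (`q, d₁, d₂, α, β ≥ 1`) with prover-2's cost
  `∫∫‖∂₂^mΦ_i‖ ≤ S₂·D₂^m` (`integral_norm_iteratedDeriv_boxWeight_snd_le_cost`) and a loss factor `Q ≥ 1`: if
  `(|h|·D₂/(2π))·Q ≤ T − 1` then the tail is `≤ 2^{k+1}·S₂·(T−1)·(Q^k)⁻¹`.

Pure analysis over landed tools; theorems only; standard axioms. Helper toward `stub_offDiagBelowSlack_io`; closes nothing.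
«The programme SEARCHES and TYPES; no claim about Landau–Siegel zeros, Theorems 1–2 of arXiv:2211.02515 or
a repaired Margin232 until a kernel theorem says so.»
-/

noncomputable section

open Real Finset MeasureTheory
open scoped FourierTransform Nat ContDiff Topology

namespace Summit.Parity.GeneralizedHardyLittlewood.Theorems.BeyondDiagonalBeatsQuarter.OffDiagPoissonTwisted

open Literature.NumberTheory.Sieve.FriedlanderIwaniecPrimes (fourier2)
open Literature.Analysis.Calculus.WhitneyConvex (dyadicBumpBound dyadicBumpBound_nonneg)
open OffDiag (boxWeight contDiff_uncurry_boxWeight hasCompactSupport_uncurry_boxWeight)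

/-! ### §1. Integer tails with a real shift -/

/-- **Integer tail with a real shift**: for `u ∈ ℝ`, `k ≥ 2`, `T ≥ 2` and a finite `S ⊆ {s : T < |s + u|}`:
`Σ_{s∈S} (|s + u|^k)⁻¹ ≤ 2^{k+1}·((T−1)^{k−1})⁻¹`. (With `m = ⌊u⌋`, `s′ = s + m`: `|s′| > T − 1 ≥ 1` and
`|s + u| ≥ |s′| − 1 ≥ |s′|/2`.) [folklore] -/
theorem sum_inv_pow_abs_add_le (u : ℝ) {k T : ℕ} (hk : 2 ≤ k) (hT : 2 ≤ T) (S : Finset ℤ)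
    (hS : ∀ s ∈ S, (T : ℝ) < |(s : ℝ) + u|) :
    ∑ s ∈ S, (|(s : ℝ) + u| ^ k)⁻¹ ≤ 2 ^ (k + 1) * (((T - 1 : ℕ) : ℝ) ^ (k - 1))⁻¹ := by
  set m : ℤ := ⌊u⌋ with hm
  have hθ0 : 0 ≤ u - m := by rw [hm]; exact sub_nonneg.mpr (Int.floor_le u)
  have hθ1 : u - m < 1 := by rw [hm]; have := Int.lt_floor_add_one u; linarith
  -- pointwise comparison with the shifted integer `s' = s + m`
  have hpt : ∀ s ∈ S, (|(s : ℝ) + u| ^ k)⁻¹ ≤ 2 ^ k * (|((s + m : ℤ) : ℝ)| ^ k)⁻¹ ∧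
      ((T - 1 : ℕ) : ℤ) < |s + m| := by
    intro s hs
    have hsu := hS s hs
    have hs' : (s : ℝ) + u = ((s + m : ℤ) : ℝ) + (u - m) := by push_cast; ring
    have hT2 : (2 : ℝ) ≤ T := by exact_mod_cast hT
    -- `|s + u| ≤ |s'| + 1` and `|s'| ≤ |s + u| + 1`
    have habs1 : |(s : ℝ) + u| ≤ |((s + m : ℤ) : ℝ)| + 1 := by
      rw [hs']
      calc |((s + m : ℤ) : ℝ) + (u - m)| ≤ |((s + m : ℤ) : ℝ)| + |u - m| := abs_add_le _ _
        _ ≤ |((s + m : ℤ) : ℝ)| + 1 := by rw [abs_of_nonneg hθ0]; linarith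
    have habs2 : |((s + m : ℤ) : ℝ)| ≤ |(s : ℝ) + u| + 1 := by
      rw [hs']
      calc |((s + m : ℤ) : ℝ)| = |(((s + m : ℤ) : ℝ) + (u - m)) - (u - m)| := by ring_nf
        _ ≤ |((s + m : ℤ) : ℝ) + (u - m)| + |u - m| := abs_sub _ _
        _ ≤ |((s + m : ℤ) : ℝ) + (u - m)| + 1 := by rw [abs_of_nonneg hθ0]; linarith
    have hgt : (T : ℝ) - 1 < |((s + m : ℤ) : ℝ)| := by linarith
    have hge1 : (1 : ℝ) < |((s + m : ℤ) : ℝ)| := by linarith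
    -- integrality: `|s'| ≥ 2`
    have h1 : (1 : ℤ) < |s + m| := by
      have : ((1 : ℤ) : ℝ) < ((|s + m| : ℤ) : ℝ) := by rw [Int.cast_abs, Int.cast_one]; exact hge1
      exact_mod_cast this
    have hs'2 : (2 : ℝ) ≤ |((s + m : ℤ) : ℝ)| := by
      have h2 : (2 : ℤ) ≤ |s + m| := h1
      have : ((2 : ℤ) : ℝ) ≤ ((|s + m| : ℤ) : ℝ) := by exact_mod_cast h2
      rwa [Int.cast_abs, Int.cast_two] at this
    have hhalf : |((s + m : ℤ) : ℝ)| / 2 ≤ |(s : ℝ) + u| := by linarith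
    have hpos' : 0 < |((s + m : ℤ) : ℝ)| / 2 := by linarith
    refine ⟨?_, ?_⟩
    · have hle : (|((s + m : ℤ) : ℝ)| / 2) ^ k ≤ |(s : ℝ) + u| ^ k := pow_le_pow_left₀ hpos'.le hhalf k
      have hpk : 0 < (|((s + m : ℤ) : ℝ)| / 2) ^ k := pow_pos hpos' k
      calc (|(s : ℝ) + u| ^ k)⁻¹ ≤ ((|((s + m : ℤ) : ℝ)| / 2) ^ k)⁻¹ := (inv_le_inv₀ (lt_of_lt_of_le hpk hle) hpk).mpr hle
        _ = 2 ^ k * (|((s + m : ℤ) : ℝ)| ^ k)⁻¹ := by rw [div_pow, inv_div, div_eq_mul_inv]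
    · have : (((T - 1 : ℕ) : ℤ) : ℝ) < ((|s + m| : ℤ) : ℝ) := by
        rw [Int.cast_abs, Int.cast_natCast, Nat.cast_sub (by omega : 1 ≤ T), Nat.cast_one]
        exact hgt
      exact_mod_cast this
  -- sum over the shifted set
  have hTm1 : 1 ≤ T - 1 := by omega
  calc ∑ s ∈ S, (|(s : ℝ) + u| ^ k)⁻¹ ≤ ∑ s ∈ S, 2 ^ k * (|((s + m : ℤ) : ℝ)| ^ k)⁻¹ :=
        Finset.sum_le_sum fun s hs ↦ (hpt s hs).1
    _ = 2 ^ k * ∑ s' ∈ S.image (· + m), (|((s' : ℤ) : ℝ)| ^ k)⁻¹ := by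
        rw [Finset.mul_sum, Finset.sum_image fun a _ b _ h ↦ add_right_cancel h]
    _ ≤ 2 ^ k * (2 * ((((T - 1 : ℕ) : ℝ)) ^ (k - 1))⁻¹) := by
        refine mul_le_mul_of_nonneg_left (sum_inv_pow_abs_int_le hk hTm1 _ fun s' hs' ↦ ?_) (by positivity)
        obtain ⟨s, hs, rfl⟩ := Finset.mem_image.mp hs'
        exact (hpt s hs).2
    _ = 2 ^ (k + 1) * (((T - 1 : ℕ) : ℝ) ^ (k - 1))⁻¹ := by ring

/-! ### §2. The shifted-lattice tail of a box transform in the second variable -/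

section Tail

variable {Φ : ℝ → ℝ → ℂ}

/-- **Finite shifted-lattice tail**: for `uncurry Φ` smooth of compact support, `h ≠ 0`, `τ, ξ₁ ∈ ℝ`, `k ≥ 2`, `T ≥ 2`, and a
finite `S ⊆ {s : T < |s + τh|}`:
`Σ_{s∈S} ‖Φ̂(ξ₁, s/h + τ)‖ ≤ 2^{k+1}·(|h|/(2π))^k·(∫∫‖∂₂^kΦ‖)·((T−1)^{k−1})⁻¹`. [folklore] -/
theorem sum_shifted_tail_norm_fourier2_le (hΦ : ContDiff ℝ ∞ (Function.uncurry Φ))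
    (hΦc : HasCompactSupport (Function.uncurry Φ)) {h : ℤ} (hh : h ≠ 0) (τ ξ₁ : ℝ) {k T : ℕ} (hk : 2 ≤ k)
    (hT : 2 ≤ T) (S : Finset ℤ) (hS : ∀ s ∈ S, (T : ℝ) < |(s : ℝ) + τ * h|) :
    ∑ s ∈ S, ‖fourier2 Φ ξ₁ ((s : ℝ) / h + τ)‖ ≤
      2 ^ (k + 1) * (|(h : ℝ)| / (2 * π)) ^ k * (((T - 1 : ℕ) : ℝ) ^ (k - 1))⁻¹ *
        ∫ t₁, ∫ t₂, ‖iteratedDeriv k (Φ t₁) t₂‖ := by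
  have hh' : (h : ℝ) ≠ 0 := by exact_mod_cast hh
  have hI0 : 0 ≤ ∫ t₁, ∫ t₂, ‖iteratedDeriv k (Φ t₁) t₂‖ :=
    integral_nonneg fun _ ↦ integral_nonneg fun _ ↦ norm_nonneg _
  -- pointwise: `k` partial integrations in `t₂`
  have hpt : ∀ s ∈ S, ‖fourier2 Φ ξ₁ ((s : ℝ) / h + τ)‖ ≤
      (|(h : ℝ)| / (2 * π)) ^ k * (∫ t₁, ∫ t₂, ‖iteratedDeriv k (Φ t₁) t₂‖) * (|(s : ℝ) + τ * h| ^ k)⁻¹ := by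
    intro s hs
    have hsu := hS s hs
    have hT0 : (0 : ℝ) < T := by exact_mod_cast (show 0 < T by omega)
    have hne : (s : ℝ) + τ * h ≠ 0 := fun h0 ↦ by rw [h0, abs_zero] at hsu; linarith
    have hξ : (s : ℝ) / h + τ = ((s : ℝ) + τ * h) / h := by field_simp
    have hξ0 : (s : ℝ) / h + τ ≠ 0 := by rw [hξ]; exact div_ne_zero hne hh'
    refine (norm_fourier2_le_right_pow_of_contDiff hΦ hΦc k ξ₁ hξ0).trans (le_of_eq ?_)
    rw [hξ, abs_div, show 2 * π * (|(s : ℝ) + τ * h| / |(h : ℝ)|) = |(s : ℝ) + τ * h| / (|(h : ℝ)| / (2 * π)) by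
      field_simp, div_pow, inv_div]
    ring
  set I : ℝ := ∫ t₁, ∫ t₂, ‖iteratedDeriv k (Φ t₁) t₂‖ with hI
  calc ∑ s ∈ S, ‖fourier2 Φ ξ₁ ((s : ℝ) / h + τ)‖
      ≤ ∑ s ∈ S, (|(h : ℝ)| / (2 * π)) ^ k * I * (|(s : ℝ) + τ * h| ^ k)⁻¹ := Finset.sum_le_sum hpt
    _ = (|(h : ℝ)| / (2 * π)) ^ k * I * ∑ s ∈ S, (|(s : ℝ) + τ * h| ^ k)⁻¹ := by rw [Finset.mul_sum]
    _ ≤ (|(h : ℝ)| / (2 * π)) ^ k * I * (2 ^ (k + 1) * (((T - 1 : ℕ) : ℝ) ^ (k - 1))⁻¹) :=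
        mul_le_mul_of_nonneg_left (sum_inv_pow_abs_add_le (τ * h) hk hT S hS) (by positivity)
    _ = _ := by ring

/-- **Shifted-lattice tail (series form)**: for `uncurry Φ` smooth of compact support, `h ≠ 0`, `τ, ξ₁ ∈ ℝ`, `k ≥ 2`, `T ≥ 2`:
`Σ'_{s∈ℤ} 𝟙[T < |s + τh|]·‖Φ̂(ξ₁, s/h + τ)‖ ≤ 2^{k+1}·(|h|/(2π))^k·(∫∫‖∂₂^kΦ‖)·((T−1)^{k−1})⁻¹`
(the lattice point `s/h + τ = (s + τh)/h`; the condition is `|ξ₂| > T/|h|`). [folklore] -/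
theorem tsum_shifted_tail_norm_fourier2_le (hΦ : ContDiff ℝ ∞ (Function.uncurry Φ))
    (hΦc : HasCompactSupport (Function.uncurry Φ)) {h : ℤ} (hh : h ≠ 0) (τ ξ₁ : ℝ) {k T : ℕ} (hk : 2 ≤ k)
    (hT : 2 ≤ T) :
    ∑' s : ℤ, (if (T : ℝ) < |(s : ℝ) + τ * h| then ‖fourier2 Φ ξ₁ ((s : ℝ) / h + τ)‖ else 0) ≤
      2 ^ (k + 1) * (|(h : ℝ)| / (2 * π)) ^ k * (((T - 1 : ℕ) : ℝ) ^ (k - 1))⁻¹ *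
        ∫ t₁, ∫ t₂, ‖iteratedDeriv k (Φ t₁) t₂‖ := by
  classical
  refine Real.tsum_le_of_sum_le (fun s ↦ by split_ifs <;> positivity) fun S ↦ ?_
  rw [← Finset.sum_filter]
  exact sum_shifted_tail_norm_fourier2_le hΦ hΦc hh τ ξ₁ hk hT _ fun s hs ↦ (Finset.mem_filter.mp hs).2

/-- The tail family is summable (comparison with the pointwise bound; in fact the whole shifted-lattice family is summable).
[folklore] -/
theorem summable_shifted_tail_norm_fourier2 (hΦ : ContDiff ℝ ∞ (Function.uncurry Φ))
    (hΦc : HasCompactSupport (Function.uncurry Φ)) {h : ℤ} (hh : h ≠ 0) (τ ξ₁ : ℝ) {T : ℕ} (hT : 2 ≤ T) :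
    Summable (fun s : ℤ ↦ if (T : ℝ) < |(s : ℝ) + τ * h| then ‖fourier2 Φ ξ₁ ((s : ℝ) / h + τ)‖ else 0) := by
  classical
  refine summable_of_sum_le (fun s ↦ by split_ifs <;> positivity) (c := 2 ^ (2 + 1) * (|(h : ℝ)| / (2 * π)) ^ 2 *
    (((T - 1 : ℕ) : ℝ) ^ (2 - 1))⁻¹ * ∫ t₁, ∫ t₂, ‖iteratedDeriv 2 (Φ t₁) t₂‖) fun S ↦ ?_
  rw [← Finset.sum_filter]
  exact sum_shifted_tail_norm_fourier2_le hΦ hΦc hh τ ξ₁ le_rfl hT _ fun s hs ↦ (Finset.mem_filter.mp hs).2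

end Tail

/-! ### §3. The box weight: the tail beyond `T − 1 ≥ |h|·D₂·Q/(2π)` is `O(S₂·(T−1)·Q^{−k})` -/

section Box

variable {q d₁ d₂ α β r : ℕ}

/-- **Shifted-lattice tail of one box weight, with prover-2's costs.** For `q, d₁, d₂, α, β ≥ 1`, a box `i`, `h ≠ 0`,
`τ, ξ₁ ∈ ℝ`, `k ≥ 2`, a loss factor `Q ≥ 1` and `T ≥ 2` with `(|h|·D₂/(2π))·Q ≤ T − 1`
(`D₂ = (1 + 4π√(βα·2K₁)/(qr)·√(2K₂))/(K₂/2)` the per-derivative cost in `t₂`):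
`Σ'_{s} 𝟙[T < |s + τh|]·‖Φ̂_i(ξ₁, s/h + τ)‖ ≤ 2^{k+1}·S₂(k)·(T−1)·(Q^k)⁻¹`, `S₂(k)` the explicit box size of
`integral_norm_iteratedDeriv_boxWeight_snd_le_cost`. [folklore] -/
theorem tsum_shifted_tail_norm_fourier2_boxWeight_le [NeZero q] (hd₁ : 1 ≤ d₁) (hd₂ : 1 ≤ d₂) (hα : 1 ≤ α)
    (hβ : 1 ≤ β) (i : ℕ × ℕ) {h : ℤ} (hh : h ≠ 0) (τ ξ₁ : ℝ) {k T : ℕ} (hk : 2 ≤ k) (hT : 2 ≤ T)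
    {Q : ℝ} (hQ : 1 ≤ Q)
    (hlen : |(h : ℝ)| * ((1 + 4 * π * Real.sqrt ((β : ℝ) * α * (2 * 2 ^ i.1)) / ((q : ℝ) * r) *
        Real.sqrt (2 * 2 ^ i.2)) / ((2 : ℝ) ^ i.2 / 2)) / (2 * π) * Q ≤ ((T - 1 : ℕ) : ℝ)) :
    ∑' s : ℤ, (if (T : ℝ) < |(s : ℝ) + τ * h| then
        ‖fourier2 (boxWeight q d₁ d₂ α β r i) ξ₁ ((s : ℝ) / h + τ)‖ else 0) ≤
      2 ^ (k + 1) * ((3 * 2 ^ i.1 / 2) * (3 * 2 ^ i.2 / 2) *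
        (∑ j ∈ Finset.range (k + 1), (k.choose j : ℝ) * (2 ^ j * dyadicBumpBound j) *
          ((((k - j : ℕ) : ℝ) + 1) ^ 2 * (k - j) ! * ((k - j : ℕ) : ℝ) ^ (k - j))) *
        (((d₂ : ℝ) * d₁ * (2 ^ i.1 / 2)) ^ (-(1 : ℝ) / 2) * (r : ℝ)⁻¹ * ((2 : ℝ) ^ i.2 / 2) ^ (-(1 : ℝ) / 2))) *
        ((T - 1 : ℕ) : ℝ) * (Q ^ k)⁻¹ := by
  set D : ℝ := (1 + 4 * π * Real.sqrt ((β : ℝ) * α * (2 * 2 ^ i.1)) / ((q : ℝ) * r) *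
        Real.sqrt (2 * 2 ^ i.2)) / ((2 : ℝ) ^ i.2 / 2) with hD
  set S₂ : ℝ := (3 * 2 ^ i.1 / 2) * (3 * 2 ^ i.2 / 2) *
        (∑ j ∈ Finset.range (k + 1), (k.choose j : ℝ) * (2 ^ j * dyadicBumpBound j) *
          ((((k - j : ℕ) : ℝ) + 1) ^ 2 * (k - j) ! * ((k - j : ℕ) : ℝ) ^ (k - j))) *
        (((d₂ : ℝ) * d₁ * (2 ^ i.1 / 2)) ^ (-(1 : ℝ) / 2) * (r : ℝ)⁻¹ * ((2 : ℝ) ^ i.2 / 2) ^ (-(1 : ℝ) / 2)) with hS₂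
  have hΦ := contDiff_uncurry_boxWeight (q := q) (r := r) hd₁ hd₂ hα hβ i
  have hΦc := hasCompactSupport_uncurry_boxWeight (q := q) (d₁ := d₁) (d₂ := d₂) (α := α) (β := β) (r := r) i
  have hcost : (∫ t₁, ∫ t₂, ‖iteratedDeriv k (boxWeight q d₁ d₂ α β r i t₁) t₂‖) ≤ S₂ * D ^ k := by
    have := integral_norm_iteratedDeriv_boxWeight_snd_le_cost (q := q) (r := r) hd₁ hd₂ hα hβ i k
    rw [hS₂, hD]; exact this
  have hsum : 0 ≤ ∑ j ∈ Finset.range (k + 1), (k.choose j : ℝ) * (2 ^ j * dyadicBumpBound j) *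
      ((((k - j : ℕ) : ℝ) + 1) ^ 2 * (k - j) ! * ((k - j : ℕ) : ℝ) ^ (k - j)) :=
    Finset.sum_nonneg fun j _ ↦ by have := dyadicBumpBound_nonneg j; positivity
  have hS0 : 0 ≤ S₂ := by
    rw [hS₂]
    have h1 : 0 ≤ ((d₂ : ℝ) * d₁ * (2 ^ i.1 / 2)) ^ (-(1 : ℝ) / 2) := Real.rpow_nonneg (by positivity) _
    have h2 : 0 ≤ ((2 : ℝ) ^ i.2 / 2) ^ (-(1 : ℝ) / 2) := Real.rpow_nonneg (by positivity) _
    positivity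
  have hD0 : 0 ≤ D := by rw [hD]; positivity
  have hT1 : (1 : ℝ) ≤ ((T - 1 : ℕ) : ℝ) := by exact_mod_cast (show 1 ≤ T - 1 by omega)
  have hT0 : (0 : ℝ) < ((T - 1 : ℕ) : ℝ) := by linarith
  have hQ0 : 0 < Q := by linarith
  -- the generic tail bound, then the cost and the length condition
  refine (tsum_shifted_tail_norm_fourier2_le hΦ hΦc hh τ ξ₁ hk hT).trans ?_
  have hx : |(h : ℝ)| / (2 * π) * D ≤ ((T - 1 : ℕ) : ℝ) * Q⁻¹ := by
    rw [← div_eq_mul_inv, le_div_iff₀ hQ0]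
    calc |(h : ℝ)| / (2 * π) * D * Q = |(h : ℝ)| * D / (2 * π) * Q := by ring
      _ ≤ ((T - 1 : ℕ) : ℝ) := hlen
  have hx0 : 0 ≤ |(h : ℝ)| / (2 * π) * D := by positivity
  have hpow : (|(h : ℝ)| / (2 * π)) ^ k * D ^ k ≤ ((T - 1 : ℕ) : ℝ) ^ k * (Q ^ k)⁻¹ := by
    rw [← mul_pow, ← inv_pow, ← mul_pow]
    exact pow_le_pow_left₀ hx0 hx k
  have hTpow : (((T - 1 : ℕ) : ℝ) ^ (k - 1))⁻¹ * ((T - 1 : ℕ) : ℝ) ^ k = ((T - 1 : ℕ) : ℝ) := by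
    have hsplit : ((T - 1 : ℕ) : ℝ) ^ k = ((T - 1 : ℕ) : ℝ) ^ (k - 1) * ((T - 1 : ℕ) : ℝ) := by
      rw [← pow_succ, Nat.sub_add_cancel (by omega : 1 ≤ k)]
    rw [hsplit, ← mul_assoc, inv_mul_cancel₀ (pow_ne_zero _ hT0.ne'), one_mul]
  calc 2 ^ (k + 1) * (|(h : ℝ)| / (2 * π)) ^ k * (((T - 1 : ℕ) : ℝ) ^ (k - 1))⁻¹ *
        ∫ t₁, ∫ t₂, ‖iteratedDeriv k (boxWeight q d₁ d₂ α β r i t₁) t₂‖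
      ≤ 2 ^ (k + 1) * (|(h : ℝ)| / (2 * π)) ^ k * (((T - 1 : ℕ) : ℝ) ^ (k - 1))⁻¹ * (S₂ * D ^ k) :=
        mul_le_mul_of_nonneg_left hcost (by positivity)
    _ = 2 ^ (k + 1) * S₂ * (((T - 1 : ℕ) : ℝ) ^ (k - 1))⁻¹ * ((|(h : ℝ)| / (2 * π)) ^ k * D ^ k) := by ring
    _ ≤ 2 ^ (k + 1) * S₂ * (((T - 1 : ℕ) : ℝ) ^ (k - 1))⁻¹ * (((T - 1 : ℕ) : ℝ) ^ k * (Q ^ k)⁻¹) :=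
        mul_le_mul_of_nonneg_left hpow (by positivity)
    _ = 2 ^ (k + 1) * S₂ * ((((T - 1 : ℕ) : ℝ) ^ (k - 1))⁻¹ * ((T - 1 : ℕ) : ℝ) ^ k) * (Q ^ k)⁻¹ := by ring
    _ = 2 ^ (k + 1) * S₂ * ((T - 1 : ℕ) : ℝ) * (Q ^ k)⁻¹ := by rw [hTpow]

end Box

end Summit.Parity.GeneralizedHardyLittlewood.Theorems.BeyondDiagonalBeatsQuarter.OffDiagPoissonTwisted
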